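import Summits.CriticalPhenomena.PercolationContinuityZ3.Theorems.PercNearOneGluingNoHeavyLowerTailSahiSunflowerTowerSymmetry
import Literature.Combinatorics.Sahi2008.Percolation
import Literature.Combinatorics.Sahi2008.PushForward
import HarnessLib

/-!
# `NoHeavyLowerTail` (crux stmt-CriticalPhenomena-4575), master-family line P2: the `m`-point "ALL-BUT-ONE-JOINED" pattern map of a finite weighted graph
# onto the sunflower poset `Sun m`, for every `m ≥ 3`

Support file (seat `prim-masterthm-p2`, gen 3; `--supports stmt-CriticalPhenomena-4575`); no named fact, no sorry.  Memo SAHI-ROUTE.md §4.10–4.12.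
Generalises `pat3` (`…SahiSunflowerAllOrdersThreePoint`) and `pat4` (`…SahiSunflowerFourPoint`, `…FourPointAllOrders`) to `m` terminals `t : Fin m → V`:
* `allBut t i` — the terminals other than `t i` lie in one open cluster (increasing); `allJoined t` — all terminals joined; for `m ≥ 3` two distinct `allBut`
  events force `allJoined` (`allJoined_of_allBut_of_allBut`);
* `Sun.pat t : BondConfig V → Sun m` — `core` if all joined, `pet i` if exactly the terminals other than `t i` are mutually joined, `out` otherwise; it is
  ANTITONE (`pat_anti`), the top row `U ([m] ∖ i)` pulls back to `(allBut t i)ᶜ` (`setInd_U_erase_comp_pat`), so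
  `E_m^{pattern weight}(row) = E_m^{percolation}((allBut t i)ᶜ : i)` = the row `mPT-LB` of the sunflower tower (`row_pat_eq`), and the pattern weight is
  Sahi-positive of order `2` (Harris transported, `sahiPositive_two_pat`);
* with the structure theorem (`Sun.sahiPositive_iff_two_and_coSingleton`): **for every `m ≥ 3`, every finite weighted graph and terminals, Sahi positivity of
  every order on the all-but-one-joined pattern algebra ⟺ `E ≥ 0` for the co-singleton `U`-families of the pattern weight** (`sahiPositive_pat_iff_coSingleton`);
  for `m ≤ 5` the companions `…Sun4AllOrders` / `…Sun5AllOrders` reduce this to the single row (`m = 3`: 3PT-LB, a theorem; `m = 4, 5`: OPEN rows).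
-/

namespace Summit.CriticalPhenomena.PercolationContinuityZ3.Theorems.SahiDeltaSystem

open Finset Function MeasureTheory Literature.Combinatorics.Sahi2008
open Literature.Probability.Percolation

variable {V : Type*} {m : ℕ}

/-- The terminals other than `t i` are mutually joined by open paths. [this work] -/
def allBut (t : Fin m → V) (i : Fin m) : Set (BondConfig V) :=
  {ω | ∀ j k, j ≠ i → k ≠ i → (openGraph ω).Reachable (t j) (t k)}

/-- All terminals are mutually joined. [this work] -/
def allJoined (t : Fin m → V) : Set (BondConfig V) := {ω | ∀ j k, (openGraph ω).Reachable (t j) (t k)}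

/-- `allJoined ⊆ allBut i`. [this work] -/
theorem allBut_of_allJoined {t : Fin m → V} {ω : BondConfig V} (h : ω ∈ allJoined t) (i : Fin m) : ω ∈ allBut t i :=
  fun j k _ _ => h j k

/-- **Two distinct all-but-one events force all terminals into one cluster** (`m ≥ 3`). [this work] -/
theorem allJoined_of_allBut_of_allBut (hm : 3 ≤ m) {t : Fin m → V} {ω : BondConfig V} {i i' : Fin m} (hii' : i ≠ i')
    (hi : ω ∈ allBut t i) (hi' : ω ∈ allBut t i') : ω ∈ allJoined t := by
  -- a third index
  obtain ⟨l, hli, hli'⟩ : ∃ l : Fin m, l ≠ i ∧ l ≠ i' := by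
    by_contra h
    push Not at h
    have hsub : (Finset.univ : Finset (Fin m)) ⊆ {i, i'} := by
      intro l _
      by_cases hl : l = i
      · simp [hl]
      · simp [h l hl]
    have := Finset.card_le_card hsub
    rw [Finset.card_univ, Fintype.card_fin] at this
    have h2 : ({i, i'} : Finset (Fin m)).card ≤ 2 := Finset.card_insert_le _ _
    omega
  have R : ∀ j k, j ≠ i → k ≠ i → (openGraph ω).Reachable (t j) (t k) := hi
  have R' : ∀ j k, j ≠ i' → k ≠ i' → (openGraph ω).Reachable (t j) (t k) := hi'
  intro j k
  by_cases hj : j = i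
  · by_cases hk : k = i
    · rw [hj, hk]
    · -- t i ~ t l (via i') and t l ~ t k (via i) unless k = i' …
      by_cases hk' : k = i'
      · subst hj; subst hk'
        exact (R' _ l hii' hli').trans (R l _ hli hii'.symm)
      · subst hj
        exact (R' _ l hii' hli').trans (R l k hli hk)
  · by_cases hk : k = i
    · by_cases hj' : j = i'
      · subst hk; subst hj'
        exact (R _ l hii'.symm hli).trans (R' l _ hli' hii')
      · subst hk
        exact (R j l hj hli).trans (R' l _ hli' hii')
    · exact R j k hj hk

/-- `allBut` is increasing. [this work] -/
theorem isUpperSet_allBut (t : Fin m → V) (i : Fin m) : IsUpperSet (allBut t i) := by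
  intro ω ω' hle h j k hj hk
  exact isUpperSet_openConn (t j) (t k) hle (h j k hj hk)

/-- `allJoined` is increasing. [this work] -/
theorem isUpperSet_allJoined (t : Fin m → V) : IsUpperSet (allJoined t) := by
  intro ω ω' hle h j k
  exact isUpperSet_openConn (t j) (t k) hle (h j k)

namespace Sun

open Classical in
/-- **The `m`-point all-but-one-joined pattern map** onto `Sun m`: `core` if all terminals are joined, `pet i` if (exactly) the terminals other than
`t i` are mutually joined, `out` if no `m − 1` of them are. [this work] -/
noncomputable def pat (t : Fin m → V) (ω : BondConfig V) : Sun m :=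
  if ω ∈ allJoined t then core else if h : ∃ i, ω ∈ allBut t i then pet (Classical.choose h) else out

/-- `pat t ω = core ↔ all joined`. [this work] -/
theorem pat_eq_core_iff (t : Fin m → V) (ω : BondConfig V) : pat t ω = core ↔ ω ∈ allJoined t := by
  unfold pat
  split_ifs with h1 h2 <;> simp [h1]

/-- `pat t ω = pet i ↔` all-but-`i` joined and not all joined (`m ≥ 3`). [this work] -/
theorem pat_eq_pet_iff (hm : 3 ≤ m) (t : Fin m → V) (ω : BondConfig V) (i : Fin m) :
    pat t ω = pet i ↔ ω ∈ allBut t i ∧ ω ∉ allJoined t := by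
  unfold pat
  split_ifs with h1 h2
  · simp [h1]
  · have hc := Classical.choose_spec h2
    constructor
    · intro h
      have hi : Classical.choose h2 = i := pet_injective h
      exact ⟨hi ▸ hc, h1⟩
    · rintro ⟨hi, -⟩
      by_contra hne
      have hne' : Classical.choose h2 ≠ i := fun h => hne (by rw [h])
      exact h1 (allJoined_of_allBut_of_allBut hm hne' hc hi)
  · simp only [false_iff, not_and, not_not]
    exact fun hi => absurd ⟨i, hi⟩ h2

/-- `pat t ω = out ↔` no `m − 1` terminals are mutually joined (`m ≥ 3`). [this work] -/
theorem pat_eq_out_iff (hm : 3 ≤ m) (t : Fin m → V) (ω : BondConfig V) : pat t ω = out ↔ ∀ i, ω ∉ allBut t i := by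
  unfold pat
  split_ifs with h1 h2
  · simp only [false_iff, not_forall, not_not]
    exact ⟨⟨0, by omega⟩, allBut_of_allJoined h1 _⟩
  · simp only [false_iff, not_forall, not_not]; exact h2
  · simp only [true_iff]; intro i hi; exact h2 ⟨i, hi⟩

/-- **The top row pulls back to the complements of the all-but-one events**: `χ_{U([m]∖i)} ∘ pat t = 1_{(allBut t i)ᶜ}` (`m ≥ 3`). [this work] -/
theorem setInd_U_erase_comp_pat (hm : 3 ≤ m) (t : Fin m → V) (i : Fin m) :
    setInd (U (Finset.univ.erase i)) ∘ pat t = DecisionTree.ind (allBut t i)ᶜ := by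
  funext ω
  simp only [Function.comp_apply, setInd_apply, DecisionTree.ind, Set.mem_compl_iff]
  have key : pat t ω ∈ U (Finset.univ.erase i) ↔ ω ∉ allBut t i := by
    rcases hω : pat t ω with _ | j | _
    · rw [pat_eq_core_iff] at hω
      simp only [core_not_mem_U, false_iff, not_not]
      exact allBut_of_allJoined hω i
    · rw [pat_eq_pet_iff hm] at hω
      simp only [pet_mem_U, Finset.mem_erase, Finset.mem_univ, and_true]
      constructor
      · intro hji hi
        exact hω.2 (allJoined_of_allBut_of_allBut hm hji hω.1 hi)
      · intro hi hji
        exact hi (hji ▸ hω.1)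
    · rw [pat_eq_out_iff hm] at hω
      simp only [out_mem_U, true_iff]
      exact hω i
  by_cases h : pat t ω ∈ U (Finset.univ.erase i)
  · rw [if_pos h, if_pos (show ω ∈ (allBut t i)ᶜ from key.1 h)]
  · rw [if_neg h, if_neg (show ω ∉ (allBut t i)ᶜ from fun h' => h (key.2 h'))]

/-- **The pattern map is antitone** (`m ≥ 3`): opening edges moves the pattern down `out → pet i → core`. [this work] -/
theorem pat_anti (hm : 3 ≤ m) (t : Fin m → V) {ω ω' : BondConfig V} (hle : ω ≤ ω') : pat t ω' ≤ pat t ω := by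
  rw [le_iff]
  rcases hω : pat t ω with _ | i | _
  · rw [pat_eq_core_iff] at hω
    exact Or.inr (Or.inr ((pat_eq_core_iff t ω').2 (isUpperSet_allJoined t hle hω)))
  · rw [pat_eq_pet_iff hm] at hω
    have hi' : ω' ∈ allBut t i := isUpperSet_allBut t i hle hω.1
    by_cases hJ : ω' ∈ allJoined t
    · exact Or.inl ((pat_eq_core_iff t ω').2 hJ)
    · exact Or.inr (Or.inr ((pat_eq_pet_iff hm t ω' i).2 ⟨hi', hJ⟩))
  · exact Or.inr (Or.inl rfl)

/-- The pattern map is monotone on the order dual of the configuration space. [this work] -/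
theorem monotone_pat_toDual (hm : 3 ≤ m) (t : Fin m → V) : Monotone (fun x : (BondConfig V)ᵒᵈ => pat t (OrderDual.ofDual x)) :=
  fun _ _ hxy => pat_anti hm t hxy

variable [Fintype V]

/-- **Order `2` of the pattern weight** (Harris for decreasing events, transported along the antitone pattern map). [this work] -/
theorem sahiPositive_two_pat (hm : 3 ≤ m) (w : Sym2 V → unitInterval) (t : Fin m → V) :
    SahiPositive (pushWeight (bernoulliWeight w) (pat t)) 2 := by
  have h := SahiPositive.of_pushWeight (sahiPositive_two (isFKGMeasure_bernoulliWeightDual w)) (monotone_pat_toDual hm t)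
  exact h

/-- The pattern weight is a probability weight: nonnegative. [this work] -/
theorem pushWeight_pat_nonneg (w : Sym2 V → unitInterval) (t : Fin m → V) (x : Sun m) : 0 ≤ pushWeight (bernoulliWeight w) (pat t) x :=
  pushWeight_nonneg (isFKGMeasure_bernoulliWeight w).nonneg _ x

/-- The pattern weight is a probability weight: total mass one. [this work] -/
theorem sum_pushWeight_pat (w : Sym2 V → unitInterval) (t : Fin m → V) : ∑ x, pushWeight (bernoulliWeight w) (pat t) x = 1 := by
  rw [sum_pushWeight, sum_bernoulliWeight]

/-- **The top row of the pattern weight is the percolation row `mPT-LB`**: `E_m^{pattern}(U([m]∖0),…) = E_m^{perc}(1_{(allBut t i)ᶜ} : i)`. [this work] -/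
theorem row_pat_eq (hm : 3 ≤ m) (w : Sym2 V → unitInterval) (t : Fin m → V) :
    sahiE (pushWeight (bernoulliWeight w) (pat t)) m (fun i => setInd (U (Finset.univ.erase i))) =
      sahiE (bernoulliWeight w) m (fun i => DecisionTree.ind (allBut t i)ᶜ) := by
  rw [sahiE_pushWeight]
  congr 1
  funext i
  exact setInd_U_erase_comp_pat hm t i

/-- **All orders on the `m`-point all-but-one-joined algebra ⟺ the co-singleton families** (`m ≥ 3`; every finite weighted graph, every `t`): by the
structure theorem for `Sun m` with the pair layer supplied by Harris. [this work] -/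
theorem sahiPositive_pat_iff_coSingleton (hm : 3 ≤ m) (w : Sym2 V → unitInterval) (t : Fin m → V) :
    (∀ n, SahiPositive (pushWeight (bernoulliWeight w) (pat t)) n) ↔
      ∀ (k : ℕ) (S : Fin (k + 3) → Finset (Fin m)) (x : Fin (k + 3) → Fin m), Function.Injective x →
        (∀ i, x i ∉ S i) → (∀ i j, i ≠ j → x i ∈ S j) →
          0 ≤ sahiE (pushWeight (bernoulliWeight w) (pat t)) (k + 3) (fun i => setInd (U (S i))) := by
  rw [sahiPositive_iff_two_and_coSingleton (pushWeight_pat_nonneg w t) (sum_pushWeight_pat w t)]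
  exact ⟨fun h => h.2, fun h => ⟨sahiPositive_two_pat hm w t, h⟩⟩

/-- **All orders ⇒ the row `mPT-LB`**: Sahi positivity of order `m` of the pattern weight gives `0 ≤ E_m(1_{(allBut t i)ᶜ} : i)` under the percolation
weight (the converse — the row alone implies all orders — is the content of `S_m`: Lean for `m ≤ 5`, certificates for `m ≤ 7`). [this work] -/
theorem row_nonneg_of_sahiPositive (hm : 3 ≤ m) (w : Sym2 V → unitInterval) (t : Fin m → V)
    (h : SahiPositive (pushWeight (bernoulliWeight w) (pat t)) m) :
    0 ≤ sahiE (bernoulliWeight w) m (fun i => DecisionTree.ind (allBut t i)ᶜ) := by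
  rw [← row_pat_eq hm]
  exact (sahiPositive_iff_indicators _ m).1 h (fun i => U (Finset.univ.erase i)) fun i => isUpperSet_U _

end Sun
end Summit.CriticalPhenomena.PercolationContinuityZ3.Theorems.SahiDeltaSystem
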